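import Literature.MathematicalPhysics.QuantumManyBody.JelliumBoseGasFoldyReduction
import Literature.MathematicalPhysics.QuantumManyBody.JelliumLowerBoundAssembly
import HarnessLib

/-!
# Foldy's law: decomposition into the Lieb–Solovej box lower bound and Solovej's upper bound

Topic `Literature/MathematicalPhysics/QuantumManyBody`; companion of `JelliumBoseGas.lean` (the named
fact `JelliumBoseGas.foldyLaw`, [LSSY2005, Thm. 10.1]). [LSSY2005, §10.1] proves Thm. 10.1 as the
conjunction of two independent published results:

* the **lower bound** of E. H. Lieb and J. P. Solovej [LiebSolovej2001, Thm. 1.1]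
  (`e₀(ρ) ≥ -I₀ ρ^{1/4}(1 + o(1))`), whose proof (§§3–9 of loc. cit.) localises into small Neumann
  boxes with a Yukawa cutoff (sliding lemma 3.1, reduction Lemma 3.3 — both PROVED in the tree,
  `SlidingLemmaJellium`, `JelliumBoxReduction`) and then establishes **Foldy's law in a small cube**
  [LiebSolovej2001, Thm. 9.2 with §9] for the one-box Hamiltonian (3.9) by rigorous Bogoliubov
  theory (§§4–8);
* the **upper bound** of J. P. Solovej [Solovej2006, Thm. 1.1] (`e₀(ρ) ≤ -I₀ ρ^{1/4}(1 + o(1))`, a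
  Bogoliubov-type trial state in Dyson's form).

In the tree the reduction of `foldyLaw` to the two UNIT-coupling finite-volume bounds is proved
(`foldyLaw_of_bounds_one`, `JelliumBoseGasFoldyReduction`: exact dilation covariance `q ↦ 1` and the
splitting into one-sided bounds), and the lower one is further reduced to the small-box statement
(`lowerBoundOne_of_boxBound`, `JelliumLowerBoundAssembly`: Lemma 3.3 and `N → ∞`). This file names
the two remaining printed results as facts and records the assembly:

* `foldyBoxLowerBound` — [LiebSolovej2001, Thm. 9.2 with the parameter choice of §9]: Foldy's law in
  the small Neumann box, uniformly in the particle number, in exactly the form consumed by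
  `lowerBoundOne_of_boxBound`;
* `foldyUpperBound_one` — [Solovej2006, Thm. 1.1] at unit coupling, finite-volume form: for every
  `ε > 0`, for all large `ρ`, eventually in `N`, `E₀(N, (N/ρ)^{1/3})/N ≤ (-I₀ + ε) ρ^{1/4}`;
* `foldyLaw_holds_of` — `foldyBoxLowerBound → foldyUpperBound_one → foldyLaw`.

## References

* [LSSY2005] E. H. Lieb, R. Seiringer, J. P. Solovej, J. Yngvason, *The Mathematics of the Bose Gas
  and its Condensation* (2005), §10.1, Thm. 10.1 with (10.2).
* [LiebSolovej2001] E. H. Lieb, J. P. Solovej, *Ground state energy of the one-component charged Bose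
  gas*, Commun. Math. Phys. 217 (2001) 127–163 (arXiv:cond-mat/0007425): Thm. 1.1, Lemma 3.3,
  Thm. 9.2 and §9; Errata 225 (2002) 219–221.
* [Solovej2006] J. P. Solovej, *Upper bounds to the ground state energies of the one- and
  two-component charged Bose gases*, Commun. Math. Phys. 266 (2006) 797–818, Thm. 1.1.
-/

noncomputable section

open MeasureTheory Set Filter Real Topology
open scoped ENNReal NNReal

namespace Literature.MathematicalPhysics.QuantumManyBody.JelliumBoseGas

open BoseGas

/-- **Foldy's law in a small cube** [LiebSolovej2001, Thm. 9.2 together with the choice of the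
localization function and of the parameters `ℓ`, `t` (`ω = ω(t)`) at the end of §9]. In the tree's
vocabulary (`boxGroundStateEnergy κ γ ρ θ ν n ℓ = inf Spec H^n_ℓ`, the one-box Neumann Hamiltonian
(3.9) of loc. cit. with kinetic coefficient `κ`, coupling `γ`, cutoff `θ` and Yukawa parameter `ν`,
`JelliumBoxHamiltonian`): for every `ε > 0` there is a localization function `χ ∈ C_c^∞(ℝ³)`,
`0 ≤ χ ≤ M`, `χ = 0` off the unit box, `∫ χ² ≠ 0`, such that for every threshold `ω₀ > 0` and all
large `ρ` one can choose `ω ≥ ω₀`, a box size `ℓ > 0` and a bound `B ≤ 0` with `B ≤ inf Spec H^n_ℓ`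
for ALL `n` (kinetic coefficient `1`, coupling `γ = (∫χ²)⁻¹`, cutoff `χ_ℓ = χ(·/ℓ)`, Yukawa
parameter `ω/ℓ`) and `B/(ρℓ³) - ω/(2ℓ) ≥ (-I₀ - ε) ρ^{1/4}`, `I₀ = foldyConstant`. Printed form:
display (9.1) of loc. cit., "`(Ψ, H^n_ℓ Ψ) ≥ (4π/3)^{1/3} A ρℓ³ (ρ^{1/4} + o(ρ^{1/4}))`" for every
normalised `n`-particle `Ψ` (one may assume `(Ψ, H^n_ℓ Ψ) ≤ 0`, whence the restriction on `n` of the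
neutral-condensation lemma and a bound `B ≤ 0` uniform in `n`; `(4π/3)^{1/3} A = -I₀` in the units of
loc. cit.), obtained from Thm. 9.2 ("Foldy's law for `H^n_ℓ`": `(Ψ, H^n_ℓ Ψ) ≥ -I n^{5/4} ℓ^{-3/4}
- C ρ^{5/4} ℓ³ (ω(t)(ρ^{1/4}ℓ)⁻¹ + ω(t)⁻¹ρ^{-1/16}(ρ^{1/4}ℓ)^{29/4} + ρ^{-1/8}(ρ^{1/4}ℓ)^{7/2})`
under the stated smallness conditions) by the choice of `X = ρ^{1/4}ℓ → ∞` and `t → 0` with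
`ρ^{1/116} t^{-16/29} ≫ X ≫ t⁻⁴` ("Completion of the proof of Foldy's law", end of §9), the term
`ω/(2ℓ)` being the self-energy cost `ω(t)N/(2ℓ)` of Lemma 3.3. In the tree, §§4–8 of loc. cit.
(Bogoliubov theory in the box) are partly available: Lemmas 5.2–5.6 in `JelliumLemma52/53/55`,
`JelliumSection5Assembly*`; small `n` in `JelliumBoxSmallN`; `JelliumBoxExcitationBound`,
`JelliumBoxCutoffs`, `JelliumBoxDecoupling`. This is exactly the hypothesis of
`lowerBoundOne_of_boxBound` (`JelliumLowerBoundAssembly`), which turns it into the Lieb–Solovej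
lower bound [LiebSolovej2001, Thm. 1.1] at unit coupling.
[cite: LiebSolovej2001, Thm. 9.2 and §9] -/
def foldyBoxLowerBound : Prop :=
  ∀ ε : ℝ, 0 < ε → ∃ (χ : Space → ℝ) (M : ℝ), ContDiff ℝ (⊤ : ℕ∞) χ ∧ HasCompactSupport χ ∧
    (∫ u, χ u ^ 2) ≠ 0 ∧ (∀ x, 0 ≤ χ x) ∧ (∀ x, χ x ≤ M) ∧ (∀ x, x ∉ box 1 → χ x = 0) ∧
    ∀ ω₀ : ℝ, 0 < ω₀ → ∃ ρ₀ : ℝ, 0 < ρ₀ ∧ ∀ ρ : ℝ, ρ₀ ≤ ρ → ∃ ω : ℝ, ω₀ ≤ ω ∧ ∃ ℓ : ℝ, 0 < ℓ ∧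
      ∃ B : ℝ, B ≤ 0 ∧
        (∀ n : ℕ, B ≤ boxGroundStateEnergy 1 (∫ u, χ u ^ 2)⁻¹ ρ (fun x => χ (ℓ⁻¹ • x)) (ω / ℓ) n ℓ) ∧
        (-foldyConstant - ε) * ρ ^ (1 / 4 : ℝ) ≤ B / (ρ * ℓ ^ 3) - ω / (2 * ℓ)

/-- **Solovej's upper bound for the one-component charged Bose gas** [Solovej2006, Thm. 1.1]:
*`e(ρ) ≤ -I₀ ρ^{5/4}(1 + o(1))` as `ρ → ∞`* (energy per volume; per particle `-I₀ ρ^{1/4}`), the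
upper half of Foldy's law [LSSY2005, Thm. 10.1]. In the tree's units and vocabulary (`μ = 1`, unit
Coulomb coupling, `I₀ = foldyConstant`; `E₀(N, L) = chargedGroundStateEnergy 0 1 ρ N L - shift` the
Dirichlet jellium ground-state energy of (10.1), `L = sideLength ρ N = (N/ρ)^{1/3}`), finite-volume
form along the thermodynamic limit: for every `ε > 0` there is `ρ₀ > 0` such that for every
`ρ ≥ ρ₀`, for all sufficiently large `N`, `E₀(N, (N/ρ)^{1/3})/N ≤ (-foldyConstant + ε) ρ^{1/4}`.
(The printed theorem bounds `limsup` of the thermodynamic-limit energy; with the existence of that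
limit for Dirichlet jellium [LiebNarnhofer1975] it yields this eventual form, which is the `hup`
hypothesis of `foldyLaw_of_bounds_one`. Proof in loc. cit.: a periodic Bogoliubov trial state in a
box of side `~ρ^{-1/4}` made Dirichlet and pasted, §§2–4.)
[cite: Solovej2006, Thm. 1.1] -/
def foldyUpperBound_one : Prop :=
  ∀ ε : ℝ, 0 < ε → ∃ ρ₀ : ℝ, 0 < ρ₀ ∧ ∀ ρ : ℝ, ρ₀ ≤ ρ → ∀ᶠ N : ℕ in atTop,
    ((chargedGroundStateEnergy 0 1 ρ N (sideLength ρ N)).toReal -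
          jelliumEnergyShift 1 ρ N (sideLength ρ N)) / N ≤
      (-foldyConstant + ε) * ρ ^ (1 / 4 : ℝ)

/-- **Assembly [LSSY2005, §10.1]: Foldy's law from the Lieb–Solovej box lower bound and Solovej's
upper bound.** `lowerBoundOne_of_boxBound` (Lemma 3.3 and `N → ∞`) turns `foldyBoxLowerBound` into the
unit-coupling lower bound, and `foldyLaw_of_bounds_one` (dilation covariance `q ↦ 1`, two one-sided
bounds, finiteness of `E₀`) concludes. [cite: LSSY2005, Thm. 10.1 (proof, §10.1)] -/
theorem foldyLaw_holds_of (hlow : foldyBoxLowerBound) (hup : foldyUpperBound_one) : foldyLaw :=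
  foldyLaw_of_bounds_one (lowerBoundOne_of_boxBound hlow) hup

end Literature.MathematicalPhysics.QuantumManyBody.JelliumBoseGas

end
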